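import Literature.Algebra.Lie.ChevalleyEilenbergLongExactSequence
import Literature.NumberTheory.Automorphic.GKCohomologyShortExact
import HarnessLib

/-!
# The long exact sequence of `(𝔤, K)`-cohomology of `0 → U → V → V/U → 0`

Topic `NumberTheory/Automorphic`; namespace `Literature.NumberTheory.Automorphic.GKSubmodule`.
Definitions with bodies and theorems; no named fact, no `sorry`.

For a `(𝔤, K)`-module `V` of a real matrix group `G` with **compact** `K` (`IsGKModule`,
`[CompactSpace G.maximalCompact]`) and a `(𝔤, K)`-stable subspace `U`, the relative cochain
complexes of `U ⊆ V ↠ V/U` form a degreewise short exact sequence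
(`GKCohomologyShortExact`: `isCochainMapTo_incl/_proj`, `inclMap_injective`, `exists_inclMap_eq`,
`exists_projMap_eq`), so the general long exact cohomology sequence of Chevalley–Eilenberg
subcomplexes (`ChevalleyEilenbergLongExactSequence`: `Subcomplex.delta`, `exact_cohomologyMap`,
`exact_delta`, `exact_delta_cohomologyMap`) specialises to the **long exact sequence of relative
Lie algebra cohomology**

`⋯ → H^q(𝔤, K; U) → H^q(𝔤, K; V) → H^q(𝔤, K; V/U) —δ→ H^{q+1}(𝔤, K; U) → ⋯`

(Borel–Wallach I §2.2: exact sequences of `(𝔤, K)`-modules split over `𝔨`, hence induce exact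
sequences of relative complexes; the cohomology sequence is that of I §5.1 / Chevalley–Eilenberg
§24).  Main declarations: `gkDelta` (the connecting homomorphism, real-linear) and `gkDeltaℂ`
(the same map, complex-linear: `gkDelta_smul` via `Subcomplex.delta_smul`),
`inclCohomologyHom` / `projCohomologyHom` (`H^q` of the inclusion / projection, the tree's
`gkCohomologyHom`), `exact_incl_proj`, `exact_proj_delta(ℂ)`, `exact_delta(ℂ)_incl`,
`inclCohomologyHom_zero_injective`, and the formula `gkDelta_toCohomology`
(`δ [z₃] = [x₁]` when `proj x₂ = z₃`, `incl x₁ = d x₂`).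

## References
* [BorelWallach2000] A. Borel, N. Wallach, *Continuous cohomology, discrete subgroups, and
  representations of reductive groups*, 2nd ed., AMS 2000, I §2.2–§2.3, §5.1.
* [ChevalleyEilenberg1948] C. Chevalley, S. Eilenberg, *Cohomology theory of Lie groups and Lie
  algebras*, Trans. AMS 63 (1948), §24.
-/

noncomputable section

namespace Literature.NumberTheory.Automorphic

open Module Function Literature.Algebra.Lie Literature.Algebra.Lie.ChevalleyEilenberg

/- [extends Literature/NumberTheory/Automorphic/GKCohomologyShortExact]: the long exact
cohomology sequence obtained from the degreewise short exact sequence there. -/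

attribute [local instance 100] LieRing.ofAssociativeRing

variable {A : Type*} [NormedCommRing A] [NormedAlgebra ℝ A] [NormedAlgebra ℚ A] [CompleteSpace A]
  [StarRing A] [StarModule ℝ A] [ContinuousStar A] {N : Type*} [Fintype N] [DecidableEq N]
  (G : RealMatrixGroup A N)
  {V : Type*} [AddCommGroup V] [Module ℂ V]
  (ρK : Representation ℂ G.maximalCompact V) (ρ𝔤 : G.lie →ₗ⁅ℝ⁆ Module.End ℂ V)

namespace GKSubmodule

variable (U : Submodule ℂ V) (hK : ∀ k : G.maximalCompact, U ≤ U.comap (ρK k))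
  (h𝔤 : ∀ X : G.lie, U ≤ U.comap (ρ𝔤 X)) (hV : IsGKModule G ρK ρ𝔤)

/-- The inclusion is injective on relative cochains. [folklore] -/
theorem carrierMap_incl_injective (q : ℕ) :
    Injective ((isCochainMapTo_incl G ρK ρ𝔤 U hK h𝔤 hV).carrierMap q) := fun _ _ h =>
  Subtype.ext (inclMap_injective G ρ𝔤 U h𝔤 q (congrArg Subtype.val h))

/-- `proj ∘ incl = 0` on relative cochains. [folklore] -/
theorem projMap_inclMap_carrier (q : ℕ)
    (f : (gkComplex G (ρK.subrepresentation U hK) (subLie G ρ𝔤 U h𝔤)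
      (isGKModule_sub G ρK ρ𝔤 U hK h𝔤 hV).ad_compat).carrier q) :
    projMap G ρ𝔤 U h𝔤 q (inclMap G ρ𝔤 U h𝔤 q f) = 0 :=
  projMap_inclMap G ρ𝔤 U h𝔤 q f

/-- Middle exactness on relative cochains, in the shape of the long exact sequence file.
[cite: BorelWallach2000, I §2.2] -/
theorem exists_inclMap_eq' (q : ℕ) (g : (gkComplex G ρK ρ𝔤 hV.ad_compat).carrier q)
    (h0 : projMap G ρ𝔤 U h𝔤 q g = 0) :
    ∃ f : (gkComplex G (ρK.subrepresentation U hK) (subLie G ρ𝔤 U h𝔤)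
        (isGKModule_sub G ρK ρ𝔤 U hK h𝔤 hV).ad_compat).carrier q,
      inclMap G ρ𝔤 U h𝔤 q f = g := by
  obtain ⟨f, hf, hfg⟩ := exists_inclMap_eq G ρK ρ𝔤 U hK h𝔤 hV q g g.2 h0
  exact ⟨⟨f, hf⟩, hfg⟩

variable [CompactSpace G.maximalCompact]

/-- The projection is surjective on relative cochains (`K` compact).
[cite: BorelWallach2000, I §2.2–2.3] -/
theorem carrierMap_proj_surjective (q : ℕ) :
    Surjective ((isCochainMapTo_proj G ρK ρ𝔤 U hK h𝔤 hV).carrierMap q) := fun h => by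
  obtain ⟨g, hg, hgh⟩ := exists_projMap_eq G ρK ρ𝔤 U hK h𝔤 hV q h h.2
  exact ⟨⟨g, hg⟩, Subtype.ext hgh⟩

/-- **The connecting homomorphism `δ : H^q(𝔤, K; V/U) → H^{q+1}(𝔤, K; U)`** of the short exact
sequence `0 → U → V → V/U → 0` of `(𝔤, K)`-modules (`K` compact).
[cite: BorelWallach2000, I §2.2, §5.1] -/
def gkDelta (q : ℕ) :
    gkCohomology G (ρK.quotient U hK) (quotLie G ρ𝔤 U h𝔤)
        (isGKModule_quot G ρK ρ𝔤 U hK h𝔤 hV).ad_compat q →ₗ[ℝ]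
      gkCohomology G (ρK.subrepresentation U hK) (subLie G ρ𝔤 U h𝔤)
        (isGKModule_sub G ρK ρ𝔤 U hK h𝔤 hV).ad_compat (q + 1) :=
  Subcomplex.delta (isCochainMapTo_incl G ρK ρ𝔤 U hK h𝔤 hV) (isCochainMapTo_proj G ρK ρ𝔤 U hK h𝔤 hV)
    (projMap_inclMap_carrier G ρK ρ𝔤 U hK h𝔤 hV) (carrierMap_incl_injective G ρK ρ𝔤 U hK h𝔤 hV)
    (exists_inclMap_eq' G ρK ρ𝔤 U hK h𝔤 hV) (carrierMap_proj_surjective G ρK ρ𝔤 U hK h𝔤 hV) q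

/-- `H^q` of the inclusion `U → V` (the tree's `gkCohomologyHom` of `U.subtype`).
[cite: BorelWallach2000, I §5.1] -/
abbrev inclCohomologyHom (q : ℕ) :=
  gkCohomologyHom G (ρK.subrepresentation U hK) (subLie G ρ𝔤 U h𝔤) ρK ρ𝔤
    (isGKModule_sub G ρK ρ𝔤 U hK h𝔤 hV).ad_compat hV.ad_compat U.subtype
    (subtype_comm𝔤 G ρ𝔤 U h𝔤) (subtype_commK G ρK U hK) q

/-- `H^q` of the projection `V → V/U` (the tree's `gkCohomologyHom` of `U.mkQ`).
[cite: BorelWallach2000, I §5.1] -/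
abbrev projCohomologyHom (q : ℕ) :=
  gkCohomologyHom G ρK ρ𝔤 (ρK.quotient U hK) (quotLie G ρ𝔤 U h𝔤) hV.ad_compat
    (isGKModule_quot G ρK ρ𝔤 U hK h𝔤 hV).ad_compat U.mkQ
    (mkQ_comm𝔤 G ρ𝔤 U h𝔤) (mkQ_commK G ρK U hK) q

/-- **Exactness at `H^q(𝔤, K; V)`**: `ker H^q(proj) = im H^q(incl)`.
[cite: BorelWallach2000, I §2.2, §5.1] -/
theorem exact_incl_proj (q : ℕ) :
    Function.Exact (inclCohomologyHom G ρK ρ𝔤 U hK h𝔤 hV q)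
      (projCohomologyHom G ρK ρ𝔤 U hK h𝔤 hV q) :=
  Subcomplex.exact_cohomologyMap (isCochainMapTo_incl G ρK ρ𝔤 U hK h𝔤 hV)
    (isCochainMapTo_proj G ρK ρ𝔤 U hK h𝔤 hV) (projMap_inclMap_carrier G ρK ρ𝔤 U hK h𝔤 hV)
    (carrierMap_incl_injective G ρK ρ𝔤 U hK h𝔤 hV) (exists_inclMap_eq' G ρK ρ𝔤 U hK h𝔤 hV)
    (carrierMap_proj_surjective G ρK ρ𝔤 U hK h𝔤 hV) q

/-- **Exactness at `H^q(𝔤, K; V/U)`**: `ker δ = im H^q(proj)`.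
[cite: BorelWallach2000, I §2.2, §5.1] -/
theorem exact_proj_delta (q : ℕ) :
    Function.Exact (projCohomologyHom G ρK ρ𝔤 U hK h𝔤 hV q) (gkDelta G ρK ρ𝔤 U hK h𝔤 hV q) :=
  Subcomplex.exact_delta (isCochainMapTo_incl G ρK ρ𝔤 U hK h𝔤 hV)
    (isCochainMapTo_proj G ρK ρ𝔤 U hK h𝔤 hV) (projMap_inclMap_carrier G ρK ρ𝔤 U hK h𝔤 hV)
    (carrierMap_incl_injective G ρK ρ𝔤 U hK h𝔤 hV) (exists_inclMap_eq' G ρK ρ𝔤 U hK h𝔤 hV)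
    (carrierMap_proj_surjective G ρK ρ𝔤 U hK h𝔤 hV) q

/-- **Exactness at `H^{q+1}(𝔤, K; U)`**: `ker H^{q+1}(incl) = im δ`.
[cite: BorelWallach2000, I §2.2, §5.1] -/
theorem exact_delta_incl (q : ℕ) :
    Function.Exact (gkDelta G ρK ρ𝔤 U hK h𝔤 hV q)
      (inclCohomologyHom G ρK ρ𝔤 U hK h𝔤 hV (q + 1)) :=
  Subcomplex.exact_delta_cohomologyMap (isCochainMapTo_incl G ρK ρ𝔤 U hK h𝔤 hV)
    (isCochainMapTo_proj G ρK ρ𝔤 U hK h𝔤 hV) (projMap_inclMap_carrier G ρK ρ𝔤 U hK h𝔤 hV)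
    (carrierMap_incl_injective G ρK ρ𝔤 U hK h𝔤 hV) (exists_inclMap_eq' G ρK ρ𝔤 U hK h𝔤 hV)
    (carrierMap_proj_surjective G ρK ρ𝔤 U hK h𝔤 hV) q

omit [CompactSpace G.maximalCompact] in
/-- **`H⁰(incl)` is injective.** [folklore] -/
theorem inclCohomologyHom_zero_injective :
    Injective (inclCohomologyHom G ρK ρ𝔤 U hK h𝔤 hV 0) :=
  Subcomplex.cohomologyMap_zero_injective (isCochainMapTo_incl G ρK ρ𝔤 U hK h𝔤 hV)
    (carrierMap_incl_injective G ρK ρ𝔤 U hK h𝔤 hV)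


/-! #### `δ` is complex-linear -/

omit [StarModule ℝ A] [ContinuousStar A] [CompactSpace G.maximalCompact] in
/-- The inclusion of cochains is `ℂ`-linear. [folklore] -/
theorem inclMap_smul (q : ℕ) (c : ℂ)
    (f : ChevalleyEilenberg.Cochain ℝ G.lie (GKCarrier G (subLie G ρ𝔤 U h𝔤)) q) :
    inclMap G ρ𝔤 U h𝔤 q (c • f) = c • inclMap G ρ𝔤 U h𝔤 q f := by
  ext v
  rfl

omit [StarModule ℝ A] [ContinuousStar A] [CompactSpace G.maximalCompact] in
/-- The projection of cochains is `ℂ`-linear. [folklore] -/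
theorem projMap_smul (q : ℕ) (c : ℂ)
    (f : ChevalleyEilenberg.Cochain ℝ G.lie (GKCarrier G ρ𝔤) q) :
    projMap G ρ𝔤 U h𝔤 q (c • f) = c • projMap G ρ𝔤 U h𝔤 q f := by
  ext v
  rfl

/-- **`δ` is `ℂ`-linear.** [cite: BorelWallach2000, I §5.1] -/
theorem gkDelta_smul (q : ℕ) (c : ℂ)
    (x : gkCohomology G (ρK.quotient U hK) (quotLie G ρ𝔤 U h𝔤)
      (isGKModule_quot G ρK ρ𝔤 U hK h𝔤 hV).ad_compat q) :
    gkDelta G ρK ρ𝔤 U hK h𝔤 hV q (c • x) = c • gkDelta G ρK ρ𝔤 U hK h𝔤 hV q x :=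
  Subcomplex.delta_smul (A := ℂ) (isCochainMapTo_incl G ρK ρ𝔤 U hK h𝔤 hV)
    (isCochainMapTo_proj G ρK ρ𝔤 U hK h𝔤 hV) (projMap_inclMap_carrier G ρK ρ𝔤 U hK h𝔤 hV)
    (carrierMap_incl_injective G ρK ρ𝔤 U hK h𝔤 hV) (exists_inclMap_eq' G ρK ρ𝔤 U hK h𝔤 hV)
    (carrierMap_proj_surjective G ρK ρ𝔤 U hK h𝔤 hV) (fun q c f => inclMap_smul G ρ𝔤 U h𝔤 q c f)
    (fun q c f => projMap_smul G ρ𝔤 U h𝔤 q c f) q c x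

/-- **The complex-linear connecting homomorphism `δ : H^q(𝔤, K; V/U) → H^{q+1}(𝔤, K; U)`.**
[cite: BorelWallach2000, I §2.2, §5.1] -/
def gkDeltaℂ (q : ℕ) :
    gkCohomology G (ρK.quotient U hK) (quotLie G ρ𝔤 U h𝔤)
        (isGKModule_quot G ρK ρ𝔤 U hK h𝔤 hV).ad_compat q →ₗ[ℂ]
      gkCohomology G (ρK.subrepresentation U hK) (subLie G ρ𝔤 U h𝔤)
        (isGKModule_sub G ρK ρ𝔤 U hK h𝔤 hV).ad_compat (q + 1) where
  toFun := gkDelta G ρK ρ𝔤 U hK h𝔤 hV q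
  map_add' := map_add _
  map_smul' := gkDelta_smul G ρK ρ𝔤 U hK h𝔤 hV q

/-- Unfolding. [folklore] -/
@[simp] theorem gkDeltaℂ_apply (q : ℕ)
    (x : gkCohomology G (ρK.quotient U hK) (quotLie G ρ𝔤 U h𝔤)
      (isGKModule_quot G ρK ρ𝔤 U hK h𝔤 hV).ad_compat q) :
    gkDeltaℂ G ρK ρ𝔤 U hK h𝔤 hV q x = gkDelta G ρK ρ𝔤 U hK h𝔤 hV q x := rfl

/-- Exactness at `H^q(𝔤, K; V/U)` for the complex-linear `δ`. [cite: BorelWallach2000, I §5.1] -/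
theorem exact_proj_deltaℂ (q : ℕ) :
    Function.Exact (projCohomologyHom G ρK ρ𝔤 U hK h𝔤 hV q) (gkDeltaℂ G ρK ρ𝔤 U hK h𝔤 hV q) :=
  exact_proj_delta G ρK ρ𝔤 U hK h𝔤 hV q

/-- Exactness at `H^{q+1}(𝔤, K; U)` for the complex-linear `δ`. [cite: BorelWallach2000, I §5.1] -/
theorem exact_deltaℂ_incl (q : ℕ) :
    Function.Exact (gkDeltaℂ G ρK ρ𝔤 U hK h𝔤 hV q)
      (inclCohomologyHom G ρK ρ𝔤 U hK h𝔤 hV (q + 1)) :=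
  exact_delta_incl G ρK ρ𝔤 U hK h𝔤 hV q

/-- **The formula for `δ`** on `(𝔤, K)`-cohomology: if `z₃` is a relative cocycle of `V/U`,
`x₂` a relative cochain of `V` over it and `x₁` a relative cochain of `U` with `incl x₁ = d x₂`,
then `δ [z₃] = [x₁]`. [cite: BorelWallach2000, I §5.1] -/
theorem gkDelta_toCohomology (q : ℕ)
    (z₃ : (gkComplex G (ρK.quotient U hK) (quotLie G ρ𝔤 U h𝔤)
      (isGKModule_quot G ρK ρ𝔤 U hK h𝔤 hV).ad_compat).cocycles q)
    (x₂ : (gkComplex G ρK ρ𝔤 hV.ad_compat).carrier q)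
    (hx₂ : projMap G ρ𝔤 U h𝔤 q x₂ = (z₃ : ChevalleyEilenberg.Cochain ℝ G.lie _ q))
    (x₁ : (gkComplex G (ρK.subrepresentation U hK) (subLie G ρ𝔤 U h𝔤)
      (isGKModule_sub G ρK ρ𝔤 U hK h𝔤 hV).ad_compat).carrier (q + 1))
    (hx₁ : inclMap G ρ𝔤 U h𝔤 (q + 1) x₁ = (gkComplex G ρK ρ𝔤 hV.ad_compat).dRes q x₂) :
    gkDelta G ρK ρ𝔤 U hK h𝔤 hV q (Subcomplex.toCohomology _ q z₃) =
      Subcomplex.toCohomology _ (q + 1) ⟨x₁, Subcomplex.mem_cocycles_of_map_eq_dRes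
        (isCochainMapTo_incl G ρK ρ𝔤 U hK h𝔤 hV) (carrierMap_incl_injective G ρK ρ𝔤 U hK h𝔤 hV)
        q x₂ x₁ hx₁⟩ :=
  Subcomplex.delta_toCohomology (isCochainMapTo_incl G ρK ρ𝔤 U hK h𝔤 hV)
    (isCochainMapTo_proj G ρK ρ𝔤 U hK h𝔤 hV) (projMap_inclMap_carrier G ρK ρ𝔤 U hK h𝔤 hV)
    (carrierMap_incl_injective G ρK ρ𝔤 U hK h𝔤 hV) (exists_inclMap_eq' G ρK ρ𝔤 U hK h𝔤 hV)
    (carrierMap_proj_surjective G ρK ρ𝔤 U hK h𝔤 hV) q z₃ x₂ hx₂ x₁ hx₁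

end GKSubmodule

end Literature.NumberTheory.Automorphic

end
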